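import Mathlib.MeasureTheory.Integral.Bochner.Basic
import Mathlib.MeasureTheory.Integral.MeanInequalities
import Mathlib.MeasureTheory.Function.L2Space
import Mathlib.Analysis.SpecialFunctions.Pow.NNReal
import HarnessLib

/-!
# Stub `stub_ensembleCS` of line `Sketch` (crux stmt-AnomalousDissipation-15510, `EnsembleRigidity.ResidualTransferSSS`)

**Cauchy–Schwarz in `L²(μ)` through a pointwise geometric-mean bound.** For an arbitrary measure
`μ` on `α`, two `μ`-a.e. nonnegative `μ`-integrable functions `a, b : α → ℝ` and any `L : α → ℝ`
with `|L| ≤ √a · √b` `μ`-a.e.,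

  `|∫ L dμ| ≤ √(∫ a dμ) · √(∫ b dμ)`.

This is the abstract ensemble Cauchy–Schwarz step of the crux: there `a u` is the (real) enstrophy
density of the ensemble, `b u` the enstrophy of the test direction, and `L u` the residual transfer
pairing. No integrability of `L` is needed: Mathlib's `norm_integral_le_of_norm_le` only asks for
integrability of the bound `√a · √b`, which is the product of two `L²(μ)` functions.

Proof: `√a, √b ∈ L²(μ)` since `(√a)² = a` a.e. (`memLp_two_iff_integrable_sq`), so `√a √b ∈ L¹(μ)`
(`MemLp.integrable_mul`); then `|∫ L| ≤ ∫ √a √b ≤ (∫ (√a)²)^{1/2} (∫ (√b)²)^{1/2}` by Hölder with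
`p = q = 2` (`integral_mul_le_Lp_mul_Lq_of_nonneg`), and `(√a)² = a`, `x^{1/2} = √x`.
-/

-- `Summit.<Summit>.<Problem>` is the tree's mandated summit-side namespace (CONVENTIONS §2); single-conjunct summit, duplicate deliberate.
set_option linter.dupNamespace false

noncomputable section

namespace Summit.AnomalousDissipation.AnomalousDissipation.Theorems.ResidualTransferSSS

open MeasureTheory Filter Topology
open scoped ENNReal NNReal

/-- The square root of an a.e.-nonnegative integrable function is in `L²`. [folklore] -/
theorem memLp_two_sqrt_of_integrable {α : Type*} [MeasurableSpace α] {μ : Measure α} {a : α → ℝ}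
    (ha : 0 ≤ᵐ[μ] a) (haI : Integrable a μ) :
    MemLp (fun x => Real.sqrt (a x)) 2 μ := by
  have hm : AEStronglyMeasurable (fun x => Real.sqrt (a x)) μ :=
    Real.continuous_sqrt.comp_aestronglyMeasurable haI.aestronglyMeasurable
  refine (memLp_two_iff_integrable_sq hm).2 (haI.congr ?_)
  filter_upwards [ha] with x hx
  exact (Real.sq_sqrt hx).symm

/-- For an a.e.-nonnegative `a`, `∫ (√a) ^ (2:ℝ) dμ = ∫ a dμ`. [folklore] -/
theorem integral_sqrt_rpow_two {α : Type*} [MeasurableSpace α] {μ : Measure α} {a : α → ℝ}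
    (ha : 0 ≤ᵐ[μ] a) :
    ∫ x, Real.sqrt (a x) ^ (2 : ℝ) ∂μ = ∫ x, a x ∂μ := by
  refine integral_congr_ae ?_
  filter_upwards [ha] with x hx
  rw [Real.rpow_two, Real.sq_sqrt hx]

/-- **Cauchy–Schwarz in `L²(μ)` through a pointwise geometric-mean bound**: if `a, b ≥ 0` a.e. are
integrable and `|L| ≤ √a √b` a.e., then `|∫ L dμ| ≤ √(∫ a dμ) √(∫ b dμ)` (no integrability of `L`
required). [folklore] -/
theorem stub_ensembleCS {α : Type*} [MeasurableSpace α] {μ : Measure α} {L a b : α → ℝ}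
    (ha : 0 ≤ᵐ[μ] a) (hb : 0 ≤ᵐ[μ] b) (haI : Integrable a μ) (hbI : Integrable b μ)
    (hL : ∀ᵐ x ∂μ, |L x| ≤ Real.sqrt (a x) * Real.sqrt (b x)) :
    |∫ x, L x ∂μ| ≤ Real.sqrt (∫ x, a x ∂μ) * Real.sqrt (∫ x, b x ∂μ) := by
  have hfL2 : MemLp (fun x => Real.sqrt (a x)) 2 μ := memLp_two_sqrt_of_integrable ha haI
  have hgL2 : MemLp (fun x => Real.sqrt (b x)) 2 μ := memLp_two_sqrt_of_integrable hb hbI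
  have hfg : Integrable (fun x => Real.sqrt (a x) * Real.sqrt (b x)) μ :=
    hfL2.integrable_mul hgL2
  have h1 : |∫ x, L x ∂μ| ≤ ∫ x, Real.sqrt (a x) * Real.sqrt (b x) ∂μ := by
    rw [← Real.norm_eq_abs]
    refine norm_integral_le_of_norm_le hfg ?_
    filter_upwards [hL] with x hx
    rw [Real.norm_eq_abs]
    exact hx
  have hp : MemLp (fun x => Real.sqrt (a x)) (ENNReal.ofReal 2) μ := by
    rw [ENNReal.ofReal_ofNat]
    exact hfL2
  have hq : MemLp (fun x => Real.sqrt (b x)) (ENNReal.ofReal 2) μ := by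
    rw [ENNReal.ofReal_ofNat]
    exact hgL2
  have h2 := integral_mul_le_Lp_mul_Lq_of_nonneg (μ := μ) Real.HolderConjugate.two_two
    (ae_of_all _ fun x => Real.sqrt_nonneg (a x)) (ae_of_all _ fun x => Real.sqrt_nonneg (b x))
    hp hq
  rw [integral_sqrt_rpow_two ha, integral_sqrt_rpow_two hb] at h2
  rw [Real.sqrt_eq_rpow, Real.sqrt_eq_rpow]
  exact h1.trans h2

end Summit.AnomalousDissipation.AnomalousDissipation.Theorems.ResidualTransferSSS

end
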